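import Literature.AlgebraicGeometry.Hyperkaehler.OGradySixType
import Literature.AlgebraicGeometry.Motives.FamiliesVHS
import Literature.AlgebraicGeometry.HodgeTheory.AbelianVarietyEndomorphismsHOne
import Literature.AlgebraicGeometry.HodgeTheory.WeilClassesCyclicPrymDimension
import Literature.AlgebraicGeometry.Motives.AbelianVarietyCohomologyExteriorH1
import Literature.Barriers.HodgeConjecture.ExceptionalHodgeClasses
import HarnessLib

/-!
# Restriction to a nonsingular fibre of a Lagrangian fibration (Shen–Yin 2022, Thm. 0.4 (b)) — NAMED FACT + kernel

Layer `Literature/AlgebraicGeometry/Hyperkaehler`.  LT-H4 open-question harvest (ladder HodgeAV; cell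
run/shared/lean/pub/vhodge/lit-oqh/), seat `hodge-lit-oqh-1` gen 5, file 11 — the PRINTED closure of
one door of the rung-H2 "transfer lens" for Weil sixfolds.  The lens seats' open shape after this
seat's LENS NOTE (2026-08-27, refereed by `hodge-lit-oqh-2`: "HK-host for `W₆` through a generically
finite rational map: closed for `dim X ≤ 10`; open shape = a `σ`-isotropic sixfold in a hyperkähler
`12`-fold carrying the restriction of an algebraic codimension-`3` class") has a sub-case that IS
settled in print: when the sixfold is a NONSINGULAR FIBRE of a LAGRANGIAN FIBRATION `π : M → B` of a
projective irreducible symplectic `M`, Shen–Yin's "Perverse = Hodge" theorem computes the image of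
`H^d(M, ℚ) → H^d(M_b, ℚ)` in every degree: it is `ℚ · η^k|_{M_b}` (`d = 2k`, `η` relatively ample)
and `0` (`d` odd).  So every class restricted from `M` to a smooth Lagrangian fibre lies in the
DIVISOR RING of the fibre, and a `2`-dimensional Weil plane `W_K ⊂ H^{2m}(A)` of an abelian
`2m`-fold `A = M_b` is never contained in the (at most `1`-dimensional) image.

## Source (read at source: held text `paper:arxiv-1812.10673`, p0003–p0004, p0011)

* J. Shen, Q. Yin, *Topology of Lagrangian fibrations and Hodge theory of hyper-Kähler manifolds*,
  Duke Math. J. 171 (2022) 209–241 [`ShenYin2022TopologyLagrangian`; REFEREED].  Setting (§0.3,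
  p0003:L86–L92), verbatim: "Let `M` denote a holomorphic symplectic variety [This means `M` is a
  simply connected nonsingular projective variety with `H⁰(M, Ω²_M)` spanned by a nowhere degenerate
  holomorphic `2`-form `σ`. …] … a Lagrangian fibration `π : M → B` with respect to the holomorphic
  symplectic form `σ` on `M` … [By definition, the base `B` of a Lagrangian fibration is always
  assumed to be normal.]"  **Theorem 0.4** (the theorem answering "a cohomological version of
  Question 0.3"; = Thm. 1.4 of the materialised text, p0004:L24–L53), verbatim: "Let `M` be a
  holomorphic symplectic variety of dimension `2n` equipped with a Lagrangian fibration `π : M → B`.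
  Then (a) the intersection cohomology of the base `B` is given by `IH^d(B, ℚ) = ⟨βᵏ⟩, d = 2k; 0,
  d = 2k+1`, where `β` is an ample divisor class on `B` …; **(b) the restriction of `H^d(M, ℚ)` to any
  nonsingular fiber `M_b ⊂ M` is given by `Im{H^d(M, ℚ) → H^d(M_b, ℚ)} = ⟨ηᵏ|_{M_b}⟩, d = 2k; 0,
  d = 2k+1`, where `η` is a `π`-relative ample divisor class on `M`.**"  Proof of (b) (§4.2,
  p0011:L20–L73): "`ηⁿ|_{M_b} ≠ 0` … gives a nontrivial class `ηᵏ|_{M_b} ∈ Im` for every `k ≤ n`.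
  Hence it suffices to show that for `k ≤ n`, `dim Im ≤ 1` (`d = 2k`), `≤ 0` (`d = 2k+1`) …
  `dim Im{H^d(M, ℚ) → H^d(M_b, ℚ)} ≤ dim H^{-n}(B, ᵖℋ^d(Rπ_*ℚ_M[n])) = ᵖh^{d,0}(M)` … Theorem (P=H)
  says that for `k ≤ n`, `ᵖh^{d,0}(M) = h^{d,0}(M) = 1, d = 2k; 0, d = 2k+1`."
* D. Matsushita (Topology 38 (1999); Math. Res. Lett. 7 (2000); Amer. J. Math. 127 (2005)): every
  surjective morphism with connected fibres from a projective irreducible symplectic `2n`-fold onto a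
  normal projective variety `B` with `0 < dim B < 2n` is a Lagrangian fibration, `dim B = n` (as
  printed in Greb–Lehn–Rollenske, Ann. Sci. ÉNS 46 (2013), Thm. 1.6; held `paper:arxiv-1105.3410`
  p0006:L38–L41) — used only to justify the HYPOTHESES chosen below, not typed.

## Rendering (tree vocabulary) and faithfulness

* `M` holomorphic symplectic variety = the tree's `IsProjectiveIrreducibleSymplectic (2 * n) M`
  (smooth projective, `M(ℂ)` simply connected, `H^{2,0}` spanned by a nowhere-degenerate form) — the
  SAME notion.  Lagrangian fibration: `π : M ⟶ B` a `ℂ`-morphism, SURJECTIVE on points, with CONNECTED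
  fibres over every complex point (`ConnectedSpace (fiberOver π t).left`), onto a SMOOTH projective
  `B` of dimension `n` (`Motives.IsSmoothProjective n B`) — a SPECIAL CASE of print (print: `B` normal;
  by Matsushita such a `π` is Lagrangian; by Hwang a smooth base is `ℙⁿ`).
  `-- TODO(general form): normal projective base B of dimension n; clause (a) on IH(B).`
* Nonsingular fibre: `s : ComplexPoints B` with `Motives.IsSmoothProjective n (fiberOver π s)` (the
  scheme-theoretic fibre `M ×_B Spec ℂ`, file `Motives/FamiliesVHS`); restriction = pull-back
  `complexBetti.map (fiberι π s) d` along the closed-fibre inclusion.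
* Conclusion, over `ℂ` (dimensions of images of the rational maps are unchanged by `⊗ ℂ`): (i) odd
  degrees: image `= ⊥`; (ii) degree `2k`: `finrank (image) ≤ 1`; (iii) `k ≤ n`: image `≠ ⊥` (the
  class `ηᵏ|_{M_b}`); (iv) degree `2k`: image `≤ Dᵏ(M_s) ⊗ ℂ` (`Barriers.HodgeConjecture.divisorClassesSpan`,
  the span of `k`-fold cup products of rational `(1,1)`-classes) — since `η|_{M_b}` is a rational
  `(1,1)`-class.  (i)–(iii) ARE the printed statement (with "`= ⟨ηᵏ|⟩`" weakened to "dimension `≤ 1`,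
  non-zero"); (iv) is its immediate consequence; nothing is stronger than print.
* D-0026: ONE new named fact; the kernel is proved.  Nothing here asserts HC / HC_AV / W₆ / HC_Kum4Type.

## Kernel (PROVED, modulo the fact)

* `….map_mem_divisorClassesSpan` — every class restricted from `M` to a nonsingular Lagrangian fibre
  lies in the divisor ring of the fibre (so it is never an "exceptional" class there);
* `….finrank_range_le_one`, `….range_odd_eq_bot` — projections;
* `….not_weilClassesOf_le_range` — for ANY identification `e : A.X ≅ M_s` of a complex abelian
  `2m`-fold with the nonsingular fibre (`n = 2m`) and ANY Weil structure `(φ, d)` on `A`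
  (`φ² = -d`, `d > 0`), the Weil plane `W_K ⊗ ℂ ⊂ H^{2m}(A(ℂ); ℂ)` (dimension `2`:
  `finrank_weilClassesOf_eq_two`, unconditional for abelian varieties) is NOT contained in the image
  of `H^{2m}(M) → H^{2m}(A)`; `….not_weilClassesOf_le_range_sixfold` — the `W₆` spelling (`m = 3`,
  `M` a hyperkähler `12`-fold): the "Lagrangian-fibre" door of the H2 transfer lens is CLOSED IN PRINT.
  What stays open is exactly what is NOT a nonsingular fibre of a Lagrangian fibration of `M` itself
  (singular fibres; isotropic images of generically finite maps of degree `> 1`; Lagrangian tori are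
  fibres of ALMOST-holomorphic Lagrangian fibrations by Hwang–Weiss 2013 / Greb–Lehn–Rollenske 2013,
  holomorphic on a birational model — not typed here).
-/

noncomputable section

open CategoryTheory

namespace Literature.AlgebraicGeometry.Hyperkaehler

open Literature.AlgebraicTopology.SingularHomology
open Literature.AlgebraicGeometry.HodgeTheory
open Literature.AlgebraicGeometry.Motives (AbelianVariety SchemeOver IsSmoothProjective ComplexPoints
  fiberOver fiberι)
open Literature.Barriers.HodgeConjecture (divisorClassesSpan)

/-! ### The named fact -/

/-- **Shen–Yin 2022, Thm. 0.4 (b) (REFEREED, Duke Math. J.): "Let `M` be a holomorphic symplectic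
variety of dimension `2n` equipped with a Lagrangian fibration `π : M → B`. Then … (b) the
restriction of `H^d(M, ℚ)` to any nonsingular fiber `M_b ⊂ M` is given by
`Im{H^d(M, ℚ) → H^d(M_b, ℚ)} = ⟨ηᵏ|_{M_b}⟩` for `d = 2k` and `0` for `d = 2k+1`, where `η` is a
`π`-relative ample divisor class on `M`."**  Rendering (module docstring): `M` projective irreducible
symplectic of dimension `2n` (`n ≥ 1`); `π : M ⟶ B` surjective with connected fibres onto a smooth
projective `B` of dimension `n` (special case of the printed normal base; Lagrangian by Matsushita);
`s` a complex point of `B` with smooth projective `n`-dimensional fibre `M_s`.  Then, for the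
pull-back `H^d(M(ℂ); ℂ) → H^d(M_s(ℂ); ℂ)` along the fibre inclusion: (i) the image vanishes in odd
degrees; (ii) it has dimension `≤ 1` in degree `2k`; (iii) it is non-zero in degree `2k` for
`k ≤ n`; (iv) it lies in the complexified divisor ring `Dᵏ(M_s)` (as `η|_{M_s}` is a rational
`(1,1)`-class).  A THEOREM in print (unproved in the tree).
[cite: ShenYin2022TopologyLagrangian, Thm. 0.4 (b) (arXiv:1812.10673 §0.3; proof §4.2 via Thm. 0.2 "Perverse = Hodge")]
[cite: VoisinHodgeII2003, §4.3 (Leray spectral sequence, edge maps = restriction to fibres)] -/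
def ShenYin2022_restriction_lagrangianFibre : Prop :=
  ∀ (n : ℕ) (M B : SchemeOver ℂ) (π : M ⟶ B), 1 ≤ n → IsProjectiveIrreducibleSymplectic (2 * n) M →
    IsSmoothProjective n B → Function.Surjective π.left.base →
    (∀ t : ComplexPoints B, ConnectedSpace (fiberOver π t).left) →
    ∀ s : ComplexPoints B, IsSmoothProjective n (fiberOver π s) →
      (∀ k : ℕ, LinearMap.range (complexBetti.map (fiberι π s) (2 * k + 1)).hom = ⊥) ∧
      (∀ k : ℕ, Module.finrank ℂ (LinearMap.range (complexBetti.map (fiberι π s) (2 * k)).hom) ≤ 1) ∧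
      (∀ k : ℕ, k ≤ n → LinearMap.range (complexBetti.map (fiberι π s) (2 * k)).hom ≠ ⊥) ∧
      (∀ k : ℕ, LinearMap.range (complexBetti.map (fiberι π s) (2 * k)).hom ≤
        divisorClassesSpan (fiberOver π s) n k)

/-! ### Kernel -/

namespace ShenYin2022_restriction_lagrangianFibre

variable {n : ℕ} {M B : SchemeOver ℂ} {π : M ⟶ B}

/-- **Every class restricted from `M` to a nonsingular Lagrangian fibre lies in the divisor ring of
the fibre** (clause (iv)). [cite: ShenYin2022TopologyLagrangian, Thm. 0.4 (b)] -/
theorem map_mem_divisorClassesSpan (h : ShenYin2022_restriction_lagrangianFibre) (hn : 1 ≤ n)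
    (hM : IsProjectiveIrreducibleSymplectic (2 * n) M) (hB : IsSmoothProjective n B)
    (hπ : Function.Surjective π.left.base) (hc : ∀ t : ComplexPoints B, ConnectedSpace (fiberOver π t).left)
    {s : ComplexPoints B} (hs : IsSmoothProjective n (fiberOver π s)) (k : ℕ)
    (c : complexBetti M (2 * k)) :
    complexBetti.map (fiberι π s) (2 * k) c ∈ divisorClassesSpan (fiberOver π s) n k :=
  (h n M B π hn hM hB hπ hc s hs).2.2.2 k ⟨c, rfl⟩

/-- Clause (ii): the image in degree `2k` is at most `1`-dimensional. [cite: ShenYin2022TopologyLagrangian, Thm. 0.4 (b)] -/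
theorem finrank_range_le_one (h : ShenYin2022_restriction_lagrangianFibre) (hn : 1 ≤ n)
    (hM : IsProjectiveIrreducibleSymplectic (2 * n) M) (hB : IsSmoothProjective n B)
    (hπ : Function.Surjective π.left.base) (hc : ∀ t : ComplexPoints B, ConnectedSpace (fiberOver π t).left)
    {s : ComplexPoints B} (hs : IsSmoothProjective n (fiberOver π s)) (k : ℕ) :
    Module.finrank ℂ (LinearMap.range (complexBetti.map (fiberι π s) (2 * k)).hom) ≤ 1 :=
  (h n M B π hn hM hB hπ hc s hs).2.1 k

/-- Clause (i): the image vanishes in odd degrees. [cite: ShenYin2022TopologyLagrangian, Thm. 0.4 (b)] -/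
theorem range_odd_eq_bot (h : ShenYin2022_restriction_lagrangianFibre) (hn : 1 ≤ n)
    (hM : IsProjectiveIrreducibleSymplectic (2 * n) M) (hB : IsSmoothProjective n B)
    (hπ : Function.Surjective π.left.base) (hc : ∀ t : ComplexPoints B, ConnectedSpace (fiberOver π t).left)
    {s : ComplexPoints B} (hs : IsSmoothProjective n (fiberOver π s)) (k : ℕ) :
    LinearMap.range (complexBetti.map (fiberι π s) (2 * k + 1)).hom = ⊥ :=
  (h n M B π hn hM hB hπ hc s hs).1 k

/-- **The Weil plane of an abelian `2m`-fold identified with a nonsingular Lagrangian fibre is NOT in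
the image of the restriction map** (`n = 2m`): for any iso `e : A.X ≅ M_s` and any Weil structure
`(φ, d)` on `A` (`φ ≫ φ = -d`, `d > 0`), `W_K ⊗ ℂ = weilClassesOf A φ m d ⊂ H^{2m}(A(ℂ); ℂ)` has
dimension `2` (`finrank_weilClassesOf_eq_two`, unconditional for abelian varieties by
`AbelianVariety.hasExteriorCohomologyH1_complexPoints` and `b₁ = 2 dim A`), whereas the image of
`H^{2m}(M) → H^{2m}(M_s) ≅ H^{2m}(A)` has dimension `≤ 1`.  Kernel, modulo the record.
[cite: ShenYin2022TopologyLagrangian, Thm. 0.4 (b)] [cite: vanGeemen1994HodgeAV, 4.9 (dim W_K = 2)] -/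
theorem not_weilClassesOf_le_range (h : ShenYin2022_restriction_lagrangianFibre) {m : ℕ} (hm : 1 ≤ m)
    (hM : IsProjectiveIrreducibleSymplectic (2 * (2 * m)) M) (hB : IsSmoothProjective (2 * m) B)
    (hπ : Function.Surjective π.left.base) (hc : ∀ t : ComplexPoints B, ConnectedSpace (fiberOver π t).left)
    {s : ComplexPoints B} (hs : IsSmoothProjective (2 * m) (fiberOver π s))
    (A : AbelianVariety ℂ) (e : A.X ≅ fiberOver π s) (hA : A.dim = 2 * m)
    {d : ℕ} (hd : 0 < d) {φ : A ⟶ A} (hφ : φ ≫ φ = -(d • 𝟙 A)) :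
    ¬ weilClassesOf A φ m d ≤ LinearMap.range (complexBetti.map (e.hom ≫ fiberι π s) (2 * m)).hom := by
  intro hle
  have h2 : Module.finrank ℂ (weilClassesOf A φ m d) = 2 :=
    finrank_weilClassesOf_eq_two (Motives.AbelianVariety.hasExteriorCohomologyH1_complexPoints (A := A))
      (by rw [Motives.AbelianVariety.finrank_complexBetti_one, hA]) (by omega) hd hφ
  haveI : Module.Finite ℂ (complexBetti (fiberOver π s) (2 * m)) :=
    finite_complexBetti_of_isSmoothProjective hs _
  haveI : Module.Finite ℂ (complexBetti A.X (2 * m)) := by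
    have hAs : IsSmoothProjective A.dim A.X := Motives.AbelianVariety.isSmoothProjective_holds (A := A)
    exact finite_complexBetti_of_isSmoothProjective hAs _
  have hr : Module.finrank ℂ (LinearMap.range (complexBetti.map (e.hom ≫ fiberι π s) (2 * m)).hom) ≤ 1 := by
    rw [complexBetti.map_comp, ModuleCat.hom_comp, LinearMap.range_comp]
    exact (Submodule.finrank_map_le _ _).trans (h.finrank_range_le_one (by omega) hM hB hπ hc hs m)
  have := Submodule.finrank_mono hle
  simp only [h2] at this
  omega

/-- **The `W₆` spelling** (rung H2 of the ladder: `m = 3`, `M` a projective irreducible symplectic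
`12`-fold with a Lagrangian fibration over a smooth `6`-dimensional base): no Weil structure on an
abelian SIXFOLD identified with a nonsingular fibre has its Weil plane inside the image of
`H⁶(M) → H⁶(A)`, and every restricted class lies in `D³(A)` — the "Lagrangian fibre" door of the
transfer lens is closed in print. [cite: ShenYin2022TopologyLagrangian, Thm. 0.4 (b)] -/
theorem not_weilClassesOf_le_range_sixfold (h : ShenYin2022_restriction_lagrangianFibre)
    (hM : IsProjectiveIrreducibleSymplectic 12 M) (hB : IsSmoothProjective 6 B)
    (hπ : Function.Surjective π.left.base) (hc : ∀ t : ComplexPoints B, ConnectedSpace (fiberOver π t).left)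
    {s : ComplexPoints B} (hs : IsSmoothProjective 6 (fiberOver π s))
    (A : AbelianVariety ℂ) (e : A.X ≅ fiberOver π s) (hA : A.dim = 2 * 3)
    {d : ℕ} (hd : 0 < d) {φ : A ⟶ A} (hφ : φ ≫ φ = -(d • 𝟙 A)) :
    ¬ weilClassesOf A φ 3 d ≤ LinearMap.range (complexBetti.map (e.hom ≫ fiberι π s) 6).hom ∧
      ∀ c : complexBetti M 6, complexBetti.map (fiberι π s) 6 c ∈ divisorClassesSpan (fiberOver π s) 6 3 :=
  ⟨h.not_weilClassesOf_le_range (m := 3) (by norm_num) hM hB hπ hc hs A e hA hd hφ,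
    fun c ↦ h.map_mem_divisorClassesSpan (n := 6) (by norm_num) hM hB hπ hc hs 3 c⟩

end ShenYin2022_restriction_lagrangianFibre

end Literature.AlgebraicGeometry.Hyperkaehler
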